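import Summits.ValiantsHypothesis.ValiantsHypothesis.Theorems.DivisionGapStDivisionEasy
import Summits.ValiantsHypothesis.ValiantsHypothesis.Theorems.DivisionGapZeroOneTransferDivSubstClosure
import Summits.ValiantsHypothesis.ValiantsHypothesis.Theorems.DivisionGapZeroOneTransferSparsePolyComplexity
import Summits.ValiantsHypothesis.ValiantsHypothesis.Theorems.DivisionGapZeroOneTransferSpanOfCertificate

/-!
# Crux `ZeroOneTransfer` (stmt-ValiantsHypothesis-5066), line `hidden-markov-intertwiner` —
# THE ENGINE: forest polynomials under sparse monotone substitutions are division-easy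

`stub_subMarkovDetDivisionEasy` (the planner's engine stub of `Cruxes/ZeroOneTransfer/Lines/hidden_markov_intertwiner.lean`,
verbatim): there is an absolute `K` (here `K = 10`) such that for all `m ≤ T`, `2 ≤ T`, every type `τ` and every
substitution `φ` of the arc variables `x_{(i,v)}` of Jerrum–Snir's arborescence polynomial `ST_m = stPoly ℝ≥0 m`
by polynomials over `ℝ≥0` with at most `T` monomials of total degree at most `T` — zero polynomials allowed —,
the forest polynomial `ST_m(φ) := aeval φ (stPoly ℝ≥0 m)` (the determinant of the sub-Markov pencil with data
`φ`, by the matrix-tree theorem) admits a nonzero cofactor `h` with `L(ST_m(φ) · h) ≤ T^K` and `L(h) ≤ T^K`,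
`L` the tree's fan-in-two `complexity` over the semiring `ℝ≥0` (monotone circuit size).  This is
Fomin–Grigoriev–Koshevoy's subtraction-free computation of directed spanning trees WITH division
(FominGrigorievKoshevoy2014 Thm 7.2, in the tree as `Summit.ValiantsHypothesis.DivisionGap.exists_stPoly_mul`:
`F = ST_m · h₀`, `h₀ > 0` at positive points, `L(F), L(h₀) ≤ 2(m+1)^4`) made UNIFORM over the substituted data:
the certificate transports along `φ` by the landed `stub_divSubstClosure` (bottom forms handle the zero data,
`complexity_aeval_le` the cost `Σ_e L(φ e)`), and each datum costs `≤ 2T² + 2T` gates by the landed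
`stub_sparsePolyComplexity`; the arithmetic `2(m+1)^4 + m(m+1)(2T²+2T) ≤ 38 T^4 ≤ T^10` is `arith_engine`.

No definitions; helper in the sub-namespace `SubMarkovEngine`.  References: FominGrigorievKoshevoy2014 §7
(star–mesh), JerrumSnir1982 §4.5 (`ST`), Bürgisser 2000 §2.1 (size bookkeeping).
-/

noncomputable section

-- Sub = Summit single-conjunct layout: the duplicated namespace component is mandated by the tree.
set_option linter.dupNamespace false

namespace Summit.ValiantsHypothesis.ValiantsHypothesis.Theorems.DivisionGapZeroOneTransfer

open Literature.Computability.AlgebraicComplexity Literature.Barriers.ValiantsHypothesis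
open MvPolynomial Finset
open scoped NNReal

namespace SubMarkovEngine

/-- The engine's arithmetic: `2(m+1)^4 + m(m+1)(2T²+2T) ≤ T^10` for `2 ≤ T`, `m ≤ T`
(`≤ 32T⁴ + 6T⁴ = 38T⁴ ≤ 64T⁴ ≤ T⁶·T⁴`). [folklore] -/
theorem arith_engine {m T : ℕ} (hT : 2 ≤ T) (hm : m ≤ T) :
    2 * (m + 1) ^ 4 + m * (m + 1) * (2 * T * T + 2 * T) ≤ T ^ 10 := by
  have h1 : m + 1 ≤ 2 * T := by omega
  have h2 : (m + 1) ^ 4 ≤ (2 * T) ^ 4 := Nat.pow_le_pow_left h1 4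
  have h3 : m * (m + 1) ≤ T * (2 * T) := Nat.mul_le_mul hm h1
  have h4 : 2 * T * T + 2 * T ≤ 3 * T * T := by nlinarith
  have h5 : 64 ≤ T ^ 6 :=
    calc 64 = 2 ^ 6 := by norm_num
      _ ≤ T ^ 6 := Nat.pow_le_pow_left hT 6
  calc 2 * (m + 1) ^ 4 + m * (m + 1) * (2 * T * T + 2 * T)
      ≤ 2 * (2 * T) ^ 4 + T * (2 * T) * (3 * T * T) :=
        Nat.add_le_add (Nat.mul_le_mul_left 2 h2) (Nat.mul_le_mul h3 h4)
    _ = 38 * T ^ 4 := by ring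
    _ ≤ T ^ 6 * T ^ 4 := Nat.mul_le_mul_right _ (by omega)
    _ = T ^ 10 := by ring

end SubMarkovEngine

/-- **The engine of line `hidden-markov-intertwiner` — sub-Markov determinants (forest polynomials) are
division-easy, uniformly in sparse data** (the planner's registered stub `stub_subMarkovDetDivisionEasy`,
verbatim, with `K = 10`): for `2 ≤ T`, `m ≤ T` and data `φ` with `≤ T` monomials of degree `≤ T` per arc,
some `h ≠ 0` has `L(ST_m(φ)·h) ≤ T^10` and `L(h) ≤ T^10`.  Proof: take FGK's star–mesh certificate
`F = ST_m · h₀` (`exists_stPoly_mul`; `h₀ ≠ 0` since it is positive at the all-ones point), transport it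
along `φ` (`stub_divSubstClosure`), pay `Σ_e L(φ e) ≤ m(m+1)(2T²+2T)` (`stub_sparsePolyComplexity`), and
absorb (`SubMarkovEngine.arith_engine`). [cite: FominGrigorievKoshevoy2014, Thm 7.2 and Lemma 7.3] -/
theorem stub_subMarkovDetDivisionEasy :
    ∃ K : ℕ, ∀ (m T : ℕ) (τ : Type) (φ : Fin m × Option (Fin m) → MvPolynomial τ NNReal),
      2 ≤ T → m ≤ T → (∀ e, (φ e).support.card ≤ T ∧ (φ e).totalDegree ≤ T) →
      ∃ h : MvPolynomial τ NNReal, h ≠ 0 ∧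
        Literature.Computability.AlgebraicComplexity.complexity
            (MvPolynomial.aeval φ (Literature.Barriers.ValiantsHypothesis.stPoly NNReal m) * h) ≤ T ^ K ∧
        Literature.Computability.AlgebraicComplexity.complexity h ≤ T ^ K := by
  refine ⟨10, fun m T τ φ hT hm hφ => ?_⟩
  obtain ⟨F, h₀, hF, hpos, hcF, hch⟩ := Summit.ValiantsHypothesis.DivisionGap.exists_stPoly_mul m
  have h₀ne : h₀ ≠ 0 := by
    intro h0
    have := hpos (fun _ => 1) (fun _ => one_pos)
    rw [h0, map_zero] at this
    exact lt_irrefl _ this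
  obtain ⟨h', h'ne, hb1, hb2⟩ := stub_divSubstClosure _ _ (stPoly ℝ≥0 m) φ h₀ h₀ne
  have hsum : ∑ e, complexity (φ e) ≤ m * (m + 1) * (2 * T * T + 2 * T) := by
    calc ∑ e, complexity (φ e) ≤ ∑ _e : Fin m × Option (Fin m), (2 * T * T + 2 * T) :=
          Finset.sum_le_sum fun e _ => stub_sparsePolyComplexity τ T (φ e) (hφ e).1 (hφ e).2
      _ = m * (m + 1) * (2 * T * T + 2 * T) := by
          rw [Finset.sum_const, Finset.card_univ, Fintype.card_prod, Fintype.card_option,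
            Fintype.card_fin, smul_eq_mul]
  have hcF' : complexity (stPoly ℝ≥0 m * h₀) ≤ 2 * (m + 1) ^ 4 := by rw [← hF]; exact hcF
  refine ⟨h', h'ne, ?_, ?_⟩
  · calc complexity (aeval φ (stPoly ℝ≥0 m) * h')
        ≤ complexity (stPoly ℝ≥0 m * h₀) + ∑ e, complexity (φ e) := hb1
      _ ≤ 2 * (m + 1) ^ 4 + m * (m + 1) * (2 * T * T + 2 * T) := add_le_add hcF' hsum
      _ ≤ T ^ 10 := SubMarkovEngine.arith_engine hT hm
  · calc complexity h' ≤ complexity h₀ + ∑ e, complexity (φ e) := hb2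
      _ ≤ 2 * (m + 1) ^ 4 + m * (m + 1) * (2 * T * T + 2 * T) := add_le_add hch hsum
      _ ≤ T ^ 10 := SubMarkovEngine.arith_engine hT hm


/-!
## Part 2 (appended by the lead, same session) — the FOREST-QUOTIENT normal form: reduction to the crux and converse
## from the crux with a degree clause

(Appended to the engine file rather than landed as its own module only because the Lean farm had not yet built this
module's olean when the reductions were ready; the two parts are the engine and the composition of ONE line.)

Two theorems that place the line's bet (registered stub `stub_forestQuotient` of
`Cruxes/ZeroOneTransfer/Lines/hidden_markov_intertwiner.lean`) exactly, kernel-checked: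

* `forestQuotientReduction` — **bet ⟹ crux.**  If every 0/1-coefficient family `f_n ∈ ℝ≥0[σ_n]` whose
  complexification is in `VP_ℂ` is a FOREST QUOTIENT — `ST_m(χ) = ST_m(ψ) · f_n · ST_m(φ)` with
  `ST_m(φ) := aeval φ (stPoly ℝ≥0 m)` (arborescence polynomial of the complete rooted digraph on `m` non-root
  nodes under a monotone substitution of its arc variables), `ST_m(φ), ST_m(ψ) ≠ 0`, and `m`, the number of
  monomials and the degree of every datum `≤ 2^{(log₂ n + c)^c}` — then `ZeroOneTransfer` holds.  Proof: the
  three forest polynomials are division-easy by the landed engine `stub_subMarkovDetDivisionEasy`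
  (FominGrigorievKoshevoy2014 Thm 7.2 uniform in sparse data), and the cofactor `h := ST(φ)h₁ · ST(ψ)h₂ · h₃`
  gives `f_n · h = (ST(χ)h₃) h₁ h₂`, so `L(f_n h) + L(h) ≤ 6 T^K + 4 ≤ 2^{(log₂ n + c₁ + K + 4)^{c₁+K+4}}`.
* `forestQuotient_of_zeroOneTransferDeg` — **crux + quasi-polynomial cofactor DEGREE ⟹ bet.**  The tree's
  converse normal form `span_of_zeroOneTransferDeg` (line `arborescence-span`, p96452) turns a certificate
  `f_n · h = g` of quasi-polynomial size AND degree into a positive `ST`-span `f_n · A = B`, `A, B ∈ Proj(ST_N)`,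
  `A ≠ 0`; a positive span IS a forest quotient (`forestQuotient_of_span`: `m := N`, `φ, χ :=` the labels of
  `A, B` — one monomial of degree `≤ 1` each —, `ψ :=` the unit data "slack `1`, arcs `0`", for which
  `ST_N(ψ) = 1`, `aeval_stPoly_unit`).

So the bet sits between `ZOT_deg` (the crux with the extra clause `deg h ≤ 2^{(log₂ n + c)^c}`) and the crux,
exactly like the bet S2 of line `arborescence-span` (`stub_spanReduction` p96454, `span_of_zeroOneTransferDeg`
p96452): the two Laplacian lines of this crux are one, and the only daylight between either bet and the crux is
the cofactor-degree clause (the regime `Negative/LowDegreeCofactor`, `Negative/Polya` leave open).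

No definitions (the unit data are written inline as `fun e => if e.2 = none then 1 else 0`); helpers in the
sub-namespace `ForestQuotient`.  References: FominGrigorievKoshevoy2014 Thm 7.2 / Remark 1.5,
HrubesYehudayoff2021 §6 (normal form `f·h = g`), JerrumSnir1982 §4.5 (`ST`).
-/

namespace ForestQuotient

/-- `6·B + 4 ≤ 2^{(a + c)^c}` for `c = c₁ + K + 4` whenever `B ≤ (2^{(a+c₁)^{c₁}})^K`. [folklore] -/
theorem qp_arith (a c₁ K : ℕ) {B : ℕ} (hB : B ≤ (2 ^ ((a + c₁) ^ c₁)) ^ K) :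
    6 * B + 4 ≤ 2 ^ ((a + (c₁ + K + 4)) ^ (c₁ + K + 4)) := by
  set E₁ := (a + c₁) ^ c₁ with hE₁
  have hE : 1 ≤ E₁ := by
    rcases Nat.eq_zero_or_pos c₁ with h | h
    · simp [hE₁, h]
    · exact Nat.one_le_pow _ _ (by omega)
  have hB' : B ≤ 2 ^ (E₁ * K) := by rwa [← pow_mul] at hB
  have hpos : 1 ≤ 2 ^ (E₁ * K) := Nat.one_le_two_pow
  have h1 : 6 * B + 4 ≤ 2 ^ (E₁ * K + 4) := by
    calc 6 * B + 4 ≤ 16 * 2 ^ (E₁ * K) := by omega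
      _ = 2 ^ (E₁ * K + 4) := by ring
  refine h1.trans (Nat.pow_le_pow_right (by norm_num) ?_)
  have h2 : E₁ ≤ (a + (c₁ + K + 4)) ^ c₁ := Nat.pow_le_pow_left (by omega) _
  have h3 : K + 4 ≤ (a + (c₁ + K + 4)) ^ (K + 4) :=
    calc K + 4 ≤ a + (c₁ + K + 4) := by omega
      _ = (a + (c₁ + K + 4)) ^ 1 := (pow_one _).symm
      _ ≤ (a + (c₁ + K + 4)) ^ (K + 4) := Nat.pow_le_pow_right (by omega) (by omega)
  calc E₁ * K + 4 ≤ E₁ * K + 4 * E₁ := by nlinarith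
    _ = E₁ * (K + 4) := by ring
    _ ≤ (a + (c₁ + K + 4)) ^ c₁ * (a + (c₁ + K + 4)) ^ (K + 4) := Nat.mul_le_mul h2 h3
    _ = (a + (c₁ + K + 4)) ^ (c₁ + K + 4) := by ring

/-- **`ST_m(unit data) = 1`**: under "slack `1`, every arc `0`" only the root star survives. [folklore] -/
theorem aeval_stPoly_unit (m : ℕ) (τ : Type) :
    MvPolynomial.aeval (fun e : Fin m × Option (Fin m) => if e.2 = none then (1 : MvPolynomial τ ℝ≥0) else 0)
      (stPoly ℝ≥0 m) = 1 := by
  classical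
  unfold stPoly
  rw [map_sum]
  rw [Finset.sum_eq_single_of_mem (fun _ : Fin m => (none : Option (Fin m)))
    (Finset.mem_filter.mpr ⟨Finset.mem_univ _, isArborescence_star⟩)]
  · rw [map_prod]
    exact Finset.prod_eq_one fun i _ => by simp
  · intro t _ ht
    have : ∃ i, t i ≠ none := by
      by_contra hcon
      push Not at hcon
      exact ht (funext hcon)
    obtain ⟨i, hi⟩ := this
    rw [map_prod]
    apply Finset.prod_eq_zero (Finset.mem_univ i)
    simp [hi]

/-- The unit data are sparse (at most one monomial, degree `0`). [folklore] -/
theorem unit_sparse (m : ℕ) (τ : Type) (e : Fin m × Option (Fin m)) :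
    ((fun e : Fin m × Option (Fin m) => if e.2 = none then (1 : MvPolynomial τ ℝ≥0) else 0) e).support.card ≤ 1 ∧
    ((fun e : Fin m × Option (Fin m) => if e.2 = none then (1 : MvPolynomial τ ℝ≥0) else 0) e).totalDegree ≤ 1 := by
  classical
  dsimp only
  split_ifs
  · constructor
    · rw [← C_1, C_apply]
      exact (Finset.card_le_card support_monomial_subset).trans (by simp)
    · rw [totalDegree_one]; exact Nat.zero_le _
  · simp

/-- Projection labels are sparse (at most one monomial, degree `≤ 1`). [folklore] -/
theorem label_sparse {ι τ : Type} {a : ι → MvPolynomial τ ℝ≥0}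
    (ha : ∀ i, (∃ j, a i = X j) ∨ ∃ c, a i = C c) (i : ι) :
    (a i).support.card ≤ 1 ∧ (a i).totalDegree ≤ 1 := by
  classical
  rcases ha i with ⟨j, hj⟩ | ⟨c, hc⟩
  · rw [hj]
    constructor
    · rw [X, support_monomial]; split_ifs <;> simp
    · rw [totalDegree_X]
  · rw [hc]
    constructor
    · rw [C_apply]
      exact (Finset.card_le_card support_monomial_subset).trans (by simp)
    · rw [totalDegree_C]; exact Nat.zero_le _

/-- **Positive `ST`-spans are forest quotients.**  If every 0/1 `VP_ℂ` family satisfies `f_n · A = B` with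
`A, B` positive Valiant projections of `ST_N` (`A ≠ 0`, `N` quasi-polynomial) — the `I = J = 1` output form of
line `arborescence-span` — then the forest-quotient normal form holds: `m := N`, `φ :=` the labels of `A`,
`χ :=` the labels of `B`, `ψ :=` unit data (`ST_N(ψ) = 1`). [folklore] -/
theorem forestQuotient_of_span
    (H : ∀ (σ : ℕ → Type) [∀ n, Fintype (σ n)] (f : ∀ n, MvPolynomial (σ n) ℝ≥0),
      (∀ n m, MvPolynomial.coeff m (f n) = 0 ∨ MvPolynomial.coeff m (f n) = 1) →
      IsVPFamily (k := ℂ) (fun n => MvPolynomial.map (Complex.ofRealHom.comp NNReal.toRealHom) (f n)) →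
      ∃ c : ℕ, ∀ n, ∃ N ≤ 2 ^ ((Nat.log 2 n + c) ^ c), ∃ A B : MvPolynomial (σ n) ℝ≥0,
        IsProjection A (stPoly ℝ≥0 N) ∧ IsProjection B (stPoly ℝ≥0 N) ∧ A ≠ 0 ∧ f n * A = B)
    (σ : ℕ → Type) [∀ n, Fintype (σ n)] (f : ∀ n, MvPolynomial (σ n) ℝ≥0)
    (h01 : ∀ n m, MvPolynomial.coeff m (f n) = 0 ∨ MvPolynomial.coeff m (f n) = 1)
    (hVP : IsVPFamily (k := ℂ) (fun n => MvPolynomial.map (Complex.ofRealHom.comp NNReal.toRealHom) (f n))) :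
    ∃ c : ℕ, ∀ n : ℕ, ∃ (m : ℕ) (φ ψ χ : Fin m × Option (Fin m) → MvPolynomial (σ n) NNReal),
      m ≤ 2 ^ ((Nat.log 2 n + c) ^ c) ∧
      (∀ e, (φ e).support.card ≤ 2 ^ ((Nat.log 2 n + c) ^ c) ∧ (φ e).totalDegree ≤ 2 ^ ((Nat.log 2 n + c) ^ c) ∧
        (ψ e).support.card ≤ 2 ^ ((Nat.log 2 n + c) ^ c) ∧ (ψ e).totalDegree ≤ 2 ^ ((Nat.log 2 n + c) ^ c) ∧
        (χ e).support.card ≤ 2 ^ ((Nat.log 2 n + c) ^ c) ∧ (χ e).totalDegree ≤ 2 ^ ((Nat.log 2 n + c) ^ c)) ∧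
      MvPolynomial.aeval φ (Literature.Barriers.ValiantsHypothesis.stPoly NNReal m) ≠ 0 ∧
      MvPolynomial.aeval ψ (Literature.Barriers.ValiantsHypothesis.stPoly NNReal m) ≠ 0 ∧
      MvPolynomial.aeval χ (Literature.Barriers.ValiantsHypothesis.stPoly NNReal m) =
        MvPolynomial.aeval ψ (Literature.Barriers.ValiantsHypothesis.stPoly NNReal m) * f n *
          MvPolynomial.aeval φ (Literature.Barriers.ValiantsHypothesis.stPoly NNReal m) := by
  obtain ⟨c, hc⟩ := H σ f h01 hVP
  refine ⟨c, fun n => ?_⟩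
  obtain ⟨N, hN, A, B, ⟨a, ha, hA⟩, ⟨b, hb, hB⟩, hA0, hAB⟩ := hc n
  have hE : 1 ≤ 2 ^ ((Nat.log 2 n + c) ^ c) := Nat.one_le_two_pow
  refine ⟨N, a, fun e => if e.2 = none then 1 else 0, b, hN, fun e => ⟨?_, ?_, ?_, ?_, ?_, ?_⟩, ?_, ?_, ?_⟩
  · exact (label_sparse ha e).1.trans hE
  · exact (label_sparse ha e).2.trans hE
  · exact (unit_sparse N (σ n) e).1.trans hE
  · exact (unit_sparse N (σ n) e).2.trans hE
  · exact (label_sparse hb e).1.trans hE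
  · exact (label_sparse hb e).2.trans hE
  · rw [← hA]; exact hA0
  · rw [aeval_stPoly_unit]; exact one_ne_zero
  · rw [aeval_stPoly_unit, one_mul, ← hA, ← hB, hAB]

end ForestQuotient

/-- **Bet ⟹ crux: the forest-quotient normal form implies `ZeroOneTransfer`** (the composition of line
`hidden-markov-intertwiner`).  Given a 0/1 family `f` with `f ⊗ ℂ ∈ VP_ℂ`, the hypothesis gives, for every `n`,
data `(m, φ, ψ, χ)` of size `≤ T := 2^{(log₂ n + c₁)^{c₁}}` with `ST(χ) = ST(ψ)·f_n·ST(φ)`, `ST(φ), ST(ψ) ≠ 0`;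
the engine `stub_subMarkovDetDivisionEasy` gives nonzero `h₁, h₂, h₃` with `L(ST(φ)h₁), L(h₁), L(ST(ψ)h₂),
L(h₂), L(ST(χ)h₃), L(h₃) ≤ T^K`; the cofactor `h := (ST(φ)h₁)(ST(ψ)h₂)h₃ ≠ 0` has `f_n·h = (ST(χ)h₃)h₁h₂`, so
`L(f_n h) + L(h) ≤ 6T^K + 4 ≤ 2^{(log₂ n + c)^c}` with `c = c₁ + K + 4`. [cite: FominGrigorievKoshevoy2014, Thm 7.2] -/
theorem forestQuotientReduction
    (hQ : ∀ (σ : ℕ → Type) [∀ n, Fintype (σ n)] (f : ∀ n, MvPolynomial (σ n) NNReal),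
      (∀ n m, MvPolynomial.coeff m (f n) = 0 ∨ MvPolynomial.coeff m (f n) = 1) →
      Literature.Computability.AlgebraicComplexity.IsVPFamily (k := ℂ)
        (fun n => MvPolynomial.map (Complex.ofRealHom.comp NNReal.toRealHom) (f n)) →
      ∃ c : ℕ, ∀ n : ℕ, ∃ (m : ℕ) (φ ψ χ : Fin m × Option (Fin m) → MvPolynomial (σ n) NNReal),
        m ≤ 2 ^ ((Nat.log 2 n + c) ^ c) ∧
        (∀ e, (φ e).support.card ≤ 2 ^ ((Nat.log 2 n + c) ^ c) ∧ (φ e).totalDegree ≤ 2 ^ ((Nat.log 2 n + c) ^ c) ∧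
          (ψ e).support.card ≤ 2 ^ ((Nat.log 2 n + c) ^ c) ∧ (ψ e).totalDegree ≤ 2 ^ ((Nat.log 2 n + c) ^ c) ∧
          (χ e).support.card ≤ 2 ^ ((Nat.log 2 n + c) ^ c) ∧ (χ e).totalDegree ≤ 2 ^ ((Nat.log 2 n + c) ^ c)) ∧
        MvPolynomial.aeval φ (Literature.Barriers.ValiantsHypothesis.stPoly NNReal m) ≠ 0 ∧
        MvPolynomial.aeval ψ (Literature.Barriers.ValiantsHypothesis.stPoly NNReal m) ≠ 0 ∧
        MvPolynomial.aeval χ (Literature.Barriers.ValiantsHypothesis.stPoly NNReal m) =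
          MvPolynomial.aeval ψ (Literature.Barriers.ValiantsHypothesis.stPoly NNReal m) * f n *
            MvPolynomial.aeval φ (Literature.Barriers.ValiantsHypothesis.stPoly NNReal m)) :
    Summit.ValiantsHypothesis.ValiantsHypothesis.Theses.DivisionGap.ZeroOneTransfer := by
  intro σ _ f h01 hVP
  obtain ⟨c₁, hc₁⟩ := hQ σ f h01 hVP
  obtain ⟨K, hK⟩ := stub_subMarkovDetDivisionEasy
  refine ⟨c₁ + K + 4, fun n => ?_⟩
  obtain ⟨m, φ, ψ, χ, hm, hdata, hφ0, hψ0, key⟩ := hc₁ n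
  set T : ℕ := 2 ^ ((Nat.log 2 n + c₁) ^ c₁) with hT
  have hT2 : 2 ≤ T := by
    have hE : 1 ≤ (Nat.log 2 n + c₁) ^ c₁ := by
      rcases Nat.eq_zero_or_pos c₁ with h | h
      · simp [h]
      · exact Nat.one_le_pow _ _ (by omega)
    calc (2 : ℕ) = 2 ^ 1 := (pow_one 2).symm
      _ ≤ 2 ^ ((Nat.log 2 n + c₁) ^ c₁) := Nat.pow_le_pow_right (by norm_num) hE
  obtain ⟨h₁, h₁0, hF₁, hh₁⟩ := hK m T (σ n) φ hT2 hm (fun e => ⟨(hdata e).1, (hdata e).2.1⟩)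
  obtain ⟨h₂, h₂0, hF₂, hh₂⟩ := hK m T (σ n) ψ hT2 hm (fun e => ⟨(hdata e).2.2.1, (hdata e).2.2.2.1⟩)
  obtain ⟨h₃, h₃0, hF₃, hh₃⟩ := hK m T (σ n) χ hT2 hm (fun e => ⟨(hdata e).2.2.2.2.1, (hdata e).2.2.2.2.2⟩)
  refine ⟨MvPolynomial.aeval φ (stPoly ℝ≥0 m) * h₁ * (MvPolynomial.aeval ψ (stPoly ℝ≥0 m) * h₂) * h₃,
    mul_ne_zero (mul_ne_zero (mul_ne_zero hφ0 h₁0) (mul_ne_zero hψ0 h₂0)) h₃0, ?_⟩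
  have e1 : f n * (MvPolynomial.aeval φ (stPoly ℝ≥0 m) * h₁ *
      (MvPolynomial.aeval ψ (stPoly ℝ≥0 m) * h₂) * h₃) =
      MvPolynomial.aeval χ (stPoly ℝ≥0 m) * h₃ * h₁ * h₂ := by
    rw [key]; ring
  rw [e1]
  have hmul := complexity_mul_le_holds (k := ℝ≥0) (σ := σ n)
  have b1 : complexity (MvPolynomial.aeval χ (stPoly ℝ≥0 m) * h₃ * h₁ * h₂) ≤ 3 * T ^ K + 2 :=
    calc complexity (MvPolynomial.aeval χ (stPoly ℝ≥0 m) * h₃ * h₁ * h₂)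
        ≤ complexity (MvPolynomial.aeval χ (stPoly ℝ≥0 m) * h₃ * h₁) + complexity h₂ + 1 := hmul _ _
      _ ≤ (complexity (MvPolynomial.aeval χ (stPoly ℝ≥0 m) * h₃) + complexity h₁ + 1) +
            complexity h₂ + 1 := by gcongr; exact hmul _ _
      _ ≤ (T ^ K + T ^ K + 1) + T ^ K + 1 := by gcongr
      _ = 3 * T ^ K + 2 := by ring
  have b2 : complexity (MvPolynomial.aeval φ (stPoly ℝ≥0 m) * h₁ *
      (MvPolynomial.aeval ψ (stPoly ℝ≥0 m) * h₂) * h₃) ≤ 3 * T ^ K + 2 :=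
    calc complexity (MvPolynomial.aeval φ (stPoly ℝ≥0 m) * h₁ *
          (MvPolynomial.aeval ψ (stPoly ℝ≥0 m) * h₂) * h₃)
        ≤ complexity (MvPolynomial.aeval φ (stPoly ℝ≥0 m) * h₁ *
            (MvPolynomial.aeval ψ (stPoly ℝ≥0 m) * h₂)) + complexity h₃ + 1 := hmul _ _
      _ ≤ (complexity (MvPolynomial.aeval φ (stPoly ℝ≥0 m) * h₁) +
            complexity (MvPolynomial.aeval ψ (stPoly ℝ≥0 m) * h₂) + 1) + complexity h₃ + 1 := by
          gcongr; exact hmul _ _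
      _ ≤ (T ^ K + T ^ K + 1) + T ^ K + 1 := by gcongr
      _ = 3 * T ^ K + 2 := by ring
  calc complexity (MvPolynomial.aeval χ (stPoly ℝ≥0 m) * h₃ * h₁ * h₂) +
        complexity (MvPolynomial.aeval φ (stPoly ℝ≥0 m) * h₁ *
          (MvPolynomial.aeval ψ (stPoly ℝ≥0 m) * h₂) * h₃)
      ≤ (3 * T ^ K + 2) + (3 * T ^ K + 2) := add_le_add b1 b2
    _ = 6 * T ^ K + 4 := by ring
    _ ≤ 2 ^ ((Nat.log 2 n + (c₁ + K + 4)) ^ (c₁ + K + 4)) := ForestQuotient.qp_arith (Nat.log 2 n) c₁ K le_rfl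

/-- **Crux + quasi-polynomial cofactor degree ⟹ bet**: `ZOT_deg` (the crux with the extra clause
`deg h ≤ 2^{(log₂ n + c)^c}`) implies the forest-quotient normal form — the tree's converse normal form
`span_of_zeroOneTransferDeg` (positive `ST`-span `f·A = B` from a certificate of quasi-polynomial size and
degree; line `arborescence-span`, p96452) followed by `ForestQuotient.forestQuotient_of_span`.  Hence the bet of
line `hidden-markov-intertwiner` sits between `ZOT_deg` and the crux, like S2 of line `arborescence-span`. [folklore] -/
theorem forestQuotient_of_zeroOneTransferDeg
    (H : ∀ (σ : ℕ → Type) [∀ n, Fintype (σ n)] (f : ∀ n, MvPolynomial (σ n) NNReal),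
      (∀ n m, MvPolynomial.coeff m (f n) = 0 ∨ MvPolynomial.coeff m (f n) = 1) →
      Literature.Computability.AlgebraicComplexity.IsVPFamily (k := ℂ)
        (fun n => MvPolynomial.map (Complex.ofRealHom.comp NNReal.toRealHom) (f n)) →
      ∃ c : ℕ, ∀ n, ∃ h : MvPolynomial (σ n) NNReal, h ≠ 0 ∧
        h.totalDegree ≤ 2 ^ ((Nat.log 2 n + c) ^ c) ∧
        Literature.Computability.AlgebraicComplexity.complexity (f n * h) +
          Literature.Computability.AlgebraicComplexity.complexity h ≤ 2 ^ ((Nat.log 2 n + c) ^ c))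
    (σ : ℕ → Type) [∀ n, Fintype (σ n)] (f : ∀ n, MvPolynomial (σ n) NNReal)
    (h01 : ∀ n m, MvPolynomial.coeff m (f n) = 0 ∨ MvPolynomial.coeff m (f n) = 1)
    (hVP : Literature.Computability.AlgebraicComplexity.IsVPFamily (k := ℂ)
      (fun n => MvPolynomial.map (Complex.ofRealHom.comp NNReal.toRealHom) (f n))) :
    ∃ c : ℕ, ∀ n : ℕ, ∃ (m : ℕ) (φ ψ χ : Fin m × Option (Fin m) → MvPolynomial (σ n) NNReal),
      m ≤ 2 ^ ((Nat.log 2 n + c) ^ c) ∧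
      (∀ e, (φ e).support.card ≤ 2 ^ ((Nat.log 2 n + c) ^ c) ∧ (φ e).totalDegree ≤ 2 ^ ((Nat.log 2 n + c) ^ c) ∧
        (ψ e).support.card ≤ 2 ^ ((Nat.log 2 n + c) ^ c) ∧ (ψ e).totalDegree ≤ 2 ^ ((Nat.log 2 n + c) ^ c) ∧
        (χ e).support.card ≤ 2 ^ ((Nat.log 2 n + c) ^ c) ∧ (χ e).totalDegree ≤ 2 ^ ((Nat.log 2 n + c) ^ c)) ∧
      MvPolynomial.aeval φ (Literature.Barriers.ValiantsHypothesis.stPoly NNReal m) ≠ 0 ∧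
      MvPolynomial.aeval ψ (Literature.Barriers.ValiantsHypothesis.stPoly NNReal m) ≠ 0 ∧
      MvPolynomial.aeval χ (Literature.Barriers.ValiantsHypothesis.stPoly NNReal m) =
        MvPolynomial.aeval ψ (Literature.Barriers.ValiantsHypothesis.stPoly NNReal m) * f n *
          MvPolynomial.aeval φ (Literature.Barriers.ValiantsHypothesis.stPoly NNReal m) :=
  ForestQuotient.forestQuotient_of_span (fun σ _ f h01 hVP => span_of_zeroOneTransferDeg H σ f h01 hVP)
    σ f h01 hVP

end Summit.ValiantsHypothesis.ValiantsHypothesis.Theorems.DivisionGapZeroOneTransfer
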